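import Summits.ABC.IUTFork.Cor312MultiradTwist
import Summits.ABC.IUTFork.Thm311PilotProofs
import HarnessLib

/-!
# [IUTchIII] Cor. 3.12, verbatim form — étale-picture transport: the statement is column-independent

Record-only file (D-0012) of the abc-iut cell (D-0067 Cor. 3.12 strategy TEAM C «étale-picture /
multiradiality», seat abc-iut-c312-13, row C-3 of `HOME/plan/C312-TEAMS.md`); TAKES NO SIDE. [IUTchIII]
Theorem 3.11 (i) (kurims `paper:url-4b091feeb646`, pp. 154–155) asserts that "the permutation symmetries of
the étale-picture … induce compatible poly-isomorphisms `Prc(^{n,∘}D⊢_T) ⥲ Prc(^{n',∘}D⊢_T)`;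
`^{n,∘}R^{LGP} ⥲ ^{n',∘}R^{LGP}`" — as typed by abc-iut-c312-1, the hypothesis `Situation.MultiradialCompat`,
equivalent (`Situation.multiradialCompat_iff_indGroup`, `Thm311PilotProofs.lean`) to: the data of any two
vertical lines differ by ONE element `Φ` of the indeterminacy group, `S.D n' = (S.D n).map Φ`.

This file derives what that étale-picture symmetry GIVES for the verbatim statement of Cor. 3.12
(`Cor312.Setting`, abc-iut-c312-7): the entire setting TRANSPORTS along `Φ` to any other column — hull
frames pushed forward, both Kummer glues translated — and the transported setting at column `n'` has THE
SAME `−|log(Θ)|`, THE SAME `−|log(q)|`, and an equivalent `Statement` (`recolumn_statement_iff`,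
`exists_recolumn_of_multiradialCompat`). The volume transport is DEFINITIONAL from c312-1's transport
`MRData.map` (admissibility and log-volume pull back along `Φ⁻¹`, `Thm311Multirad.lean`): no volume
invariance hypothesis is consumed anywhere. The proof of Cor. 3.12 reads both pilot images in one column
after bringing them there through the Θ×μ_LGP-link (Steps (viii)–(ix), p. 180 l. 1–42); this file is the
étale-side half of that step — WHICH column carries the comparison is immaterial.

ISOLATION (unchanged by this file, stated so nobody over-reads it): column transport is VOLUME-LEVEL. It
does not produce the SET-level inclusion of Step (xi-f) (q-pilot image inside the hull of the possible
images) — that the types do not force it is of record: c312-4 `mainGoal_is_the_extra_input`,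
`ForkInd1Passive.setLevel_forces_active`, c312-6 `verbatim_edge_not_imp_readings`. Nothing here asserts
Cor. 3.12 and nothing here asserts `MultiradialCompat` (it stays a hypothesis of Thm. 3.11 (i)).
[claim: Mochizuki2012, status: disputed] for the quoted clauses; bookkeeping proofs are [folklore].
-/

noncomputable section

namespace Summit.ABC.IUTFork.Cor312

open Thm311 Literature.IUT.LogThetaLattice

/-! ## 1. Generalities: subsets and intersections along a bijection -/

/-- A subset lies in the image of `H` under a bijection iff its preimage (= image under the inverse) lies
in `H`. [folklore] -/
theorem equiv_subset_image_iff {X Y : Type} (e : X ≃ Y) (A : Set Y) (H : Set X) :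
    A ⊆ ⇑e '' H ↔ ⇑e.symm '' A ⊆ H := by
  constructor
  · rintro h _ ⟨y, hy, rfl⟩
    obtain ⟨x, hx, rfl⟩ := h hy
    simpa using hx
  · intro h y hy
    have hx : e.symm y ∈ H := h ⟨y, hy, rfl⟩
    exact ⟨e.symm y, hx, by simp⟩

/-- The image of an intersection of a family of subsets under a bijection is the intersection of the
images (for a bijection no nonemptiness hypothesis is needed: the empty family gives `univ` on both
sides). [folklore] -/
theorem equiv_image_sInter {X Y : Type} (e : X ≃ Y) (𝒮 : Set (Set X)) :
    ⇑e '' ⋂₀ 𝒮 = ⋂₀ ((Set.image ⇑e) '' 𝒮) := by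
  ext y
  simp only [Set.mem_image, Set.mem_sInter]
  constructor
  · rintro ⟨x, hx, rfl⟩ A hA
    obtain ⟨A₀, hA₀, rfl⟩ := hA
    exact ⟨x, hx A₀ hA₀, rfl⟩
  · intro h
    refine ⟨e.symm y, fun A₀ hA₀ => ?_, by simp⟩
    obtain ⟨x, hx, hxy⟩ := h (⇑e '' A₀) ⟨A₀, hA₀, rfl⟩
    have hx' : x = e.symm y := by
      rw [← hxy]
      simp
    rwa [← hx']

/-! ## 2. Pushforward of a hull frame along a bijection -/

namespace HullFrame

variable {X Y : Type} (F : HullFrame X) (e : X ≃ Y)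

/-- The PUSHFORWARD of a hull frame along a bijection `e : X ≃ Y`: hull-sets are the images of the
hull-sets, relative compactness and hull-existence are read back through `e⁻¹`. This is how the hull data
"labeled `n, ∘`" ([IUTchIII] Rmk. 3.9.5 (i)) transports along the étale-picture symmetries of Thm. 3.11
(i): the packet automorphism carries the frame of one column to the frame of another.
[claim: Mochizuki2012, status: disputed] -/
def pushforward : HullFrame Y where
  Hul := (Set.image ⇑e) '' F.Hul
  IsBounded A := F.IsBounded (⇑e.symm '' A)
  HasHull A := F.HasHull (⇑e.symm '' A)
  hul_bounded := by
    rintro _ ⟨H, hH, rfl⟩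
    rw [Equiv.symm_image_image]
    exact F.hul_bounded H hH
  bounded_mono := fun U U' h hU' => F.bounded_mono _ _ (Set.image_mono h) hU'
  exists_hul := by
    intro U hU
    obtain ⟨H, hH, hsub⟩ := F.exists_hul _ hU
    exact ⟨⇑e '' H, ⟨H, hH, rfl⟩, (equiv_subset_image_iff e U H).mpr hsub⟩
  hull_mem := by
    intro U hU hh
    have hset : {H | H ∈ (Set.image ⇑e) '' F.Hul ∧ U ⊆ H} =
        (Set.image ⇑e) '' {H₀ | H₀ ∈ F.Hul ∧ ⇑e.symm '' U ⊆ H₀} := by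
      ext H
      simp only [Set.mem_setOf_eq, Set.mem_image]
      constructor
      · rintro ⟨⟨H₀, hH₀, rfl⟩, hsub⟩
        exact ⟨H₀, ⟨hH₀, (equiv_subset_image_iff e U H₀).mp hsub⟩, rfl⟩
      · rintro ⟨H₀, ⟨hH₀, hsub⟩, rfl⟩
        exact ⟨⟨H₀, hH₀, rfl⟩, (equiv_subset_image_iff e U H₀).mpr hsub⟩
    rw [hset, ← equiv_image_sInter]
    exact ⟨_, F.hull_mem _ hU hh, rfl⟩

/-- Membership in the pushed-forward hull-sets. [folklore] -/
theorem mem_pushforward_hul_iff (A : Set Y) :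
    A ∈ (F.pushforward e).Hul ↔ ∃ H ∈ F.Hul, ⇑e '' H = A := Iff.rfl

/-- **The pushed-forward hull is the image of the hull of the preimage**: the holomorphic hull commutes
with transport along a bijection of the packet. [folklore] -/
theorem pushforward_hull (U : Set Y) :
    (F.pushforward e).hull U = ⇑e '' F.hull (⇑e.symm '' U) := by
  unfold HullFrame.hull
  by_cases h : F.IsBounded (⇑e.symm '' U)
  · rw [if_pos (show (F.pushforward e).IsBounded U from h), if_pos h]
    have hset : {H | H ∈ (F.pushforward e).Hul ∧ U ⊆ H} =
        (Set.image ⇑e) '' {H₀ | H₀ ∈ F.Hul ∧ ⇑e.symm '' U ⊆ H₀} := by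
      ext H
      simp only [mem_pushforward_hul_iff, Set.mem_setOf_eq, Set.mem_image]
      constructor
      · rintro ⟨⟨H₀, hH₀, rfl⟩, hsub⟩
        exact ⟨H₀, ⟨hH₀, (equiv_subset_image_iff e U H₀).mp hsub⟩, rfl⟩
      · rintro ⟨H₀, ⟨hH₀, hsub⟩, rfl⟩
        exact ⟨⟨H₀, hH₀, rfl⟩, (equiv_subset_image_iff e U H₀).mpr hsub⟩
    rw [hset, ← equiv_image_sInter]
  · rw [if_neg (show ¬(F.pushforward e).IsBounded U from h), if_neg h]
    rw [Set.image_univ, Equiv.range_eq_univ]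

end HullFrame

/-! ## 3. Transport of the whole setting to another column along one indeterminacy -/

namespace Setting

variable {T : ThetaIndex} {S : Situation T} (P : Setting S)

/-- **The TRANSPORT of the setting of Cor. 3.12 to the column `n'`** along a packet-automorphism family
`Φ` realising the étale-picture symmetry (Thm. 3.11 (i): `S.D n' = (S.D P.n).map Φ` — the form
`Situation.multiradialCompat_iff_indGroup` extracts from `MultiradialCompat`): hull frames are pushed
forward along `Φ`, both Kummer glues (the Θ-side `thetaRegionOf` of Thm. 3.11 (ii) AND the q-side
`qRegionOf` of [IUTchII] Cor. 4.10 (i)) are translated by `Φ`, the lattice/theater/pilot context is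
untouched. Admissibility of the transported hull-sets and finiteness of the transported q-support are
PROVED from `P`'s fields — the transport `MRData.map` pulls admissibility and log-volume back along
`Φ⁻¹` (c312-1, `Thm311Multirad.lean`), so the two cancel definitionally.
[claim: Mochizuki2012, status: disputed] -/
def recolumn (n' : ℤ) (Φ : S.L.PacketAut) (hD : S.D n' = (S.D P.n).map Φ) : Setting S :=
  { P with
    n := n'
    frame := fun j vQ => (P.frame j vQ).pushforward (Φ j vQ).toEquiv
    hul_adm := by
      rintro j vQ H hH
      obtain ⟨H₀, hH₀, rfl⟩ := hH
      rw [hD]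
      show (S.D P.n).Adm j vQ (⇑(Φ j vQ).symm '' (⇑(Φ j vQ) '' H₀))
      rw [image_symm_image]
      exact P.hul_adm j vQ H₀ hH₀
    thetaRegionOf := fun m ob j vQ => Φ j vQ '' P.thetaRegionOf m ob j vQ
    qRegionOf := fun ob j vQ => Φ j vQ '' P.qRegionOf ob j vQ
    qRegion_mem := fun j vQ => ⟨P.qRegionOf (qPilotObject P.qData) j vQ, P.qRegion_mem j vQ, rfl⟩
    qSupport_finite := by
      intro j
      have key : (Function.support fun vQ =>
          (S.D n').logvol j vQ (Φ j vQ '' P.qRegionOf (qPilotObject P.qData) j vQ)) =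
          Function.support fun vQ =>
          (S.D P.n).logvol j vQ (P.qRegionOf (qPilotObject P.qData) j vQ) := by
        apply congrArg
        funext vQ
        rw [hD]
        show (S.D P.n).logvol j vQ
          (⇑(Φ j vQ).symm '' (⇑(Φ j vQ) '' P.qRegionOf (qPilotObject P.qData) j vQ)) = _
        rw [image_symm_image]
      show (Function.support fun vQ =>
        (S.D n').logvol j vQ (Φ j vQ '' P.qRegionOf (qPilotObject P.qData) j vQ)).Finite
      rw [key]
      exact P.qSupport_finite j }

section Recolumn

variable (n' : ℤ) (Φ : S.L.PacketAut) (hD : S.D n' = (S.D P.n).map Φ)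

/-- The transport lands in the column `n'`. [folklore] -/
theorem recolumn_n : (P.recolumn n' Φ hD).n = n' := rfl

/-- The transported Kummer image at `(m, j, v_ℚ)` is the `Φ`-translate. [folklore] -/
theorem recolumn_thetaRegion (m : ℤ) (j : T.Label) (vQ : T.VQ) :
    (P.recolumn n' Φ hD).thetaRegion m j vQ = Φ j vQ '' P.thetaRegion m j vQ := rfl

/-- The transported q-pilot image is the `Φ`-translate. [folklore] -/
theorem recolumn_qRegion (j : T.Label) (vQ : T.VQ) :
    (P.recolumn n' Φ hD).qRegion j vQ = Φ j vQ '' P.qRegion j vQ := rfl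

/-- The transported (Ind3)-region is the `Φ`-translate. [folklore] -/
theorem recolumn_thetaRegion3 (j : T.Label) (vQ : T.VQ) :
    (P.recolumn n' Φ hD).thetaRegion3 j vQ = Φ j vQ '' P.thetaRegion3 j vQ := by
  unfold thetaRegion3
  simp only [recolumn_thetaRegion, Set.image_iUnion]

/-- For `Φ` in the indeterminacy group, the transported setting has THE SAME possible images (orbit
absorption, `twistGlue_possibleImages` — the transported glue is precisely the twisted glue). [folklore] -/
theorem recolumn_possibleImages (hΦ : Φ ∈ indGroup S) (j : T.Label) (vQ : T.VQ) :
    (P.recolumn n' Φ hD).possibleImages j vQ = P.possibleImages j vQ := by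
  have h : (P.recolumn n' Φ hD).possibleImages j vQ = (P.twistGlue Φ).possibleImages j vQ := rfl
  rw [h, P.twistGlue_possibleImages Φ hΦ]

/-- The union of the possible images is also fixed by the INVERSE of an indeterminacy (apply
`image_sUnion_possibleImages` to `Φ⁻¹`, or cancel directly). [folklore] -/
theorem symm_image_sUnion_possibleImages {Φ : S.L.PacketAut} (hΦ : Φ ∈ indGroup S) (j : T.Label)
    (vQ : T.VQ) :
    ⇑(Φ j vQ).symm '' ⋃₀ P.possibleImages j vQ = ⋃₀ P.possibleImages j vQ := by
  conv_lhs => rw [← P.image_sUnion_possibleImages hΦ (j := j) (vQ := vQ)]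
  rw [image_symm_image]

/-- The transported hull `^{n',∘}𝒰_{j,v_ℚ}` is the `Φ`-translate of the original hull: the holomorphic
hull commutes with the étale-picture transport. [folklore] -/
theorem recolumn_thetaHull (hΦ : Φ ∈ indGroup S) (j : T.Label) (vQ : T.VQ) :
    (P.recolumn n' Φ hD).thetaHull j vQ = ⇑(Φ j vQ) '' P.thetaHull j vQ := by
  unfold thetaHull
  rw [show (P.recolumn n' Φ hD).frame j vQ = (P.frame j vQ).pushforward (Φ j vQ).toEquiv from rfl,
    HullFrame.pushforward_hull]
  show ⇑(Φ j vQ) '' (P.frame j vQ).hull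
      (⇑(Φ j vQ).symm '' ⋃₀ (P.recolumn n' Φ hD).possibleImages j vQ) = _
  rw [P.recolumn_possibleImages n' Φ hD hΦ, P.symm_image_sUnion_possibleImages hΦ]

/-- The transported hull is defined iff the original is. [folklore] -/
theorem recolumn_hullDefined_iff (hΦ : Φ ∈ indGroup S) (j : T.Label) (vQ : T.VQ) :
    (P.recolumn n' Φ hD).HullDefined j vQ ↔ P.HullDefined j vQ := by
  unfold HullDefined
  rw [P.recolumn_possibleImages n' Φ hD hΦ]
  show (P.frame j vQ).IsBounded (⇑(Φ j vQ).symm '' ⋃₀ P.possibleImages j vQ) ∧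
      (P.frame j vQ).HasHull (⇑(Φ j vQ).symm '' ⋃₀ P.possibleImages j vQ) ↔ _
  rw [P.symm_image_sUnion_possibleImages hΦ]

/-- **VOLUME TRANSPORT, Θ-side**: the local Θ-contribution at the new column equals the original — the
log-volume of the transported hull, read in the transported data `(S.D n').logvol = ((S.D P.n).map Φ).logvol`,
cancels definitionally against the translation (no volume-invariance hypothesis!). [folklore] -/
theorem recolumn_thetaLocal (hΦ : Φ ∈ indGroup S) (j : T.Label) (vQ : T.VQ) :
    (P.recolumn n' Φ hD).thetaLocal j vQ = P.thetaLocal j vQ := by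
  have hd := P.recolumn_hullDefined_iff n' Φ hD hΦ j vQ
  unfold thetaLocal
  by_cases h : P.HullDefined j vQ
  · rw [if_pos h, if_pos (hd.mpr h)]
    rw [P.recolumn_thetaHull n' Φ hD hΦ j vQ]
    refine congrArg (fun r : ℝ => (r : WithTop ℝ)) ?_
    rw [P.recolumn_n n' Φ hD, hD]
    show (S.D P.n).logvol j vQ (⇑(Φ j vQ).symm '' (⇑(Φ j vQ) '' P.thetaHull j vQ)) = _
    rw [image_symm_image]
  · rw [if_neg h, if_neg fun hc => h (hd.mp hc)]

/-- The finiteness clause transports. [folklore] -/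
theorem recolumn_thetaFinite_iff (hΦ : Φ ∈ indGroup S) :
    (P.recolumn n' Φ hD).ThetaFinite ↔ P.ThetaFinite := by
  have hl : (P.recolumn n' Φ hD).thetaLocal = P.thetaLocal :=
    funext fun j => funext fun vQ => P.recolumn_thetaLocal n' Φ hD hΦ j vQ
  unfold ThetaFinite
  rw [hl]

/-- **`−|log(Θ)|` IS COLUMN-INDEPENDENT** along the étale-picture transport. [folklore] -/
theorem recolumn_negLogTheta (hΦ : Φ ∈ indGroup S) :
    (P.recolumn n' Φ hD).negLogTheta = P.negLogTheta := by
  have hl : (P.recolumn n' Φ hD).thetaLocal = P.thetaLocal :=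
    funext fun j => funext fun vQ => P.recolumn_thetaLocal n' Φ hD hΦ j vQ
  have hf := P.recolumn_thetaFinite_iff n' Φ hD hΦ
  unfold negLogTheta
  by_cases h : P.ThetaFinite
  · rw [if_pos h, if_pos (hf.mpr h), hl]
  · rw [if_neg h, if_neg fun hc => h (hf.mp hc)]

/-- **VOLUME TRANSPORT, q-side**: the local q-contribution transports definitionally (no indeterminacy
membership needed — the q-pilot is "not subject to" (Ind1)(Ind2)(Ind3), and its transport is by the same
`Φ` the data transports by). [folklore] -/
theorem recolumn_qLocal (j : T.Label) (vQ : T.VQ) :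
    (P.recolumn n' Φ hD).qLocal j vQ = P.qLocal j vQ := by
  unfold qLocal
  rw [P.recolumn_n n' Φ hD, hD]
  show (S.D P.n).logvol j vQ (⇑(Φ j vQ).symm '' (⇑(Φ j vQ) '' P.qRegion j vQ)) = _
  rw [image_symm_image]

/-- **`−|log(q)|` IS COLUMN-INDEPENDENT** along the étale-picture transport. [folklore] -/
theorem recolumn_negLogQ : (P.recolumn n' Φ hD).negLogQ = P.negLogQ := by
  unfold negLogQ
  congr 1
  funext i
  exact finsum_congr fun vQ => P.recolumn_qLocal n' Φ hD (labelSucc i) vQ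

/-- **COLUMN INDEPENDENCE OF THE STATEMENT**: the printed conclusion of Cor. 3.12 holds in the transported
setting at column `n'` iff it holds at column `P.n`. [folklore] -/
theorem recolumn_statement_iff (hΦ : Φ ∈ indGroup S) :
    (P.recolumn n' Φ hD).Statement ↔ P.Statement := by
  unfold Statement
  rw [P.recolumn_negLogTheta n' Φ hD hΦ, P.recolumn_negLogQ n' Φ hD]

end Recolumn

/-! ## 4. The headline, under Theorem 3.11 (i)'s étale-picture symmetry -/

/-- **ÉTALE-PICTURE TRANSPORT THEOREM**: under the multiradial compatibility of Thm. 3.11 (i) as typed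
(`Situation.MultiradialCompat` — a HYPOTHESIS, not asserted), the setting of Cor. 3.12 transports to EVERY
column with both printed quantities unchanged and the statement equivalent: which vertical line of the
log-theta-lattice carries the comparison of the two pilot images is immaterial. This is the étale-side
content of Steps (viii)–(ix) of the proof (p. 180 l. 1–42); it is VOLUME-LEVEL transport and does NOT
produce the set-level inclusion of Step (xi-f) (see the module docstring). [folklore] -/
theorem exists_recolumn_of_multiradialCompat (hMR : S.MultiradialCompat) (n' : ℤ) :
    ∃ P' : Setting S, P'.n = n' ∧ P'.negLogTheta = P.negLogTheta ∧ P'.negLogQ = P.negLogQ ∧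
      (P'.Statement ↔ P.Statement) := by
  obtain ⟨Φ, hΦ, hD⟩ := (Situation.multiradialCompat_iff_indGroup S).mp hMR P.n n'
  have hΦ' : Φ ∈ indGroup S := hΦ
  exact ⟨P.recolumn n' Φ hD, rfl, P.recolumn_negLogTheta n' Φ hD hΦ',
    P.recolumn_negLogQ n' Φ hD, P.recolumn_statement_iff n' Φ hD hΦ'⟩

end Setting

end Summit.ABC.IUTFork.Cor312

end
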